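import Literature.AnabelianGeometry.SemiGraphs.TemperedPiDecomposition
import Literature.GroupTheory.CompactGroupIntersections
import HarnessLib

/-!
# Stabilisers of compatible vertex systems lie in decomposition images ([SemiAnbd] §3 p. 41)

Mochizuki, *Semi-graphs of anabelioids*, Publ. RIMS **42** (2006), §3, proof of Thm. 3.7 (iii), author's
manuscript p. 41 [cite: MochizukiSemiAnbd2006, Thm 3.7(iii) p.41]: "there exists a compatible system of
vertices of `𝒢_{∞,j}` … each of which is fixed by `H` … Thus, we conclude that `H` is contained in some
verticial subgroup" (with the author's *Comments* (2020), item (6)(a)).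

Sequel to `TemperedPiDecomposition.lean` (seat abc-iut-L3-t6, row «DECOMP»).  TREE HALF of the
identification (I2) of `TemperedLevelData.lean`:

* `PointSeq.mem_range_decompHom_of_fixes` — an element of `π₁^temp(𝒢) = lim_n Aut(𝒢_{∞,n})` fixing
  the vertex system `[t n]` of a compatible point sequence `t` lies in the image of the decomposition
  homomorphism `Π_v → π₁^temp(𝒢)` at `t` (at each level its component is `σ_n^{k_n}` for a coset of
  `k_n`; the cosets decrease and are closed, so compactness of `Π_v` gives one `k`);
* `exists_pointSeq_vertex_eq` — every compatible vertex system of the trees `𝔾̃_n` is the vertex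
  system of a compatible point sequence (dependent choice along the tower);
* `exists_decompHom_range_of_fixes` — hence the pointwise stabiliser of any compatible vertex system
  lies in the image of a decomposition homomorphism `Π_v → π₁^temp(𝒢)`.

What (I2) still needs beyond this file is the chart-side statement that these images are VERTICIAL
subgroups (the natural isomorphism of Prop. 3.2 / Thm. 3.7 (i)). Nothing here bears on [IUTchIII] Cor. 3.12.
-/

namespace Literature.AnabelianGeometry.SemiGraphs

namespace ProfiniteSemiGraph

namespace GaloisLevelData

open CategoryTheory Topology
open Literature.GroupTheory.CompactGroupIntersections (exists_mem_forall_of_antitone)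

universe u

variable {𝒢 : ProfiniteSemiGraph.{u}} (D : GaloisLevelData 𝒢) (h𝒢 : 𝒢.IsCountable)

/-- `treeTrans` over one step is `treeStep`. [cite: MochizukiSemiAnbd2006, Thm 3.7(iii) p.41] -/
theorem treeTrans_le_succ (n : ℕ) : D.treeTrans (Nat.le_succ n) = D.treeStep n := by
  rw [D.treeTrans_succ (le_refl n), D.treeTrans_self, Category.comp_id]

/-- The structure morphism `𝔾̃_n → 𝔾` on a vertex `(V, p)` is the base vertex of the orbit `V`.
[cite: MochizukiSemiAnbd2006, Thm 3.7(iii) p.41] -/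
theorem treeProj_vertexMap (n : ℕ) (x : (D.tree n).Vertex) :
    (D.treeProj n).vertexMap x = CovObj.OVertex.base (D.S n) x.1 := rfl

/-- The vertices of `𝒢_{∞,n}` (read in `𝔾̃_n`) are injectively labelled by their orbits: two points with
the same vertex have the same `Π_v`-orbit. [cite: MochizukiSemiAnbd2006, Prop 3.6 p.38] -/
theorem mk_eq_mk_of_vertexMap_eq (n : ℕ) {v : 𝒢.graph.Vertex} (t t' : ((D.cover h𝒢 n).SV v).obj.V)
    (h : (D.treeIso h𝒢 n).hom.vertexMap (Quot.mk _ ⟨v, t⟩) =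
      (D.treeIso h𝒢 n).hom.vertexMap (Quot.mk _ ⟨v, t'⟩)) :
    (Quot.mk (D.cover h𝒢 n).VRel ⟨v, t⟩ : (D.cover h𝒢 n).OVertex) = Quot.mk _ ⟨v, t'⟩ :=
  (D.S n).univCoverOverVertex_injective (Sum.inl (D.W n)) h𝒢 h

namespace PointSeq

variable {D h𝒢} {v : 𝒢.graph.Vertex} (T : D.PointSeq h𝒢 v)

/-! ### (I2), tree half: the stabiliser lies in the image -/

/-- The fibres of `h ↦ σ_n^h` are closed (it is continuous into a discrete group).
[cite: MochizukiSemiAnbd2006, Thm 3.7(i) p.40] -/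
theorem isClosed_setOf_gal_eq (n : ℕ) (σ : D.Gal h𝒢 n) : IsClosed {h : 𝒢.Gv v | T.gal n h = σ} :=
  isClosed_singleton.preimage ((D.continuous_proj h𝒢 n).comp T.continuous_decompHom)

/-- If `g ∈ π₁^temp` fixes the vertex `[t n]` of `𝔾̃_n`, its `n`-th component is some `σ_n^k`.
[cite: MochizukiSemiAnbd2006, Thm 3.7(iii) p.41] -/
theorem exists_gal_eq_proj_of_fixes (n : ℕ) (g : D.temperedPi h𝒢)
    (hg : (D.treeAct h𝒢 n g).hom.vertexMap (T.vertex n) = T.vertex n) :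
    ∃ k : 𝒢.Gv v, T.gal n k = D.proj h𝒢 n g := by
  rw [D.treeAct_apply] at hg
  unfold vertex at hg
  rw [D.galTreeAct_vertexMap_mk h𝒢 n] at hg
  obtain ⟨k, hk⟩ := (D.cover h𝒢 n).exists_ρ_of_mk_eq_mk (D.mk_eq_mk_of_vertexMap_eq h𝒢 n _ _ hg)
  refine ⟨k, (T.eq_gal n k _ ?_).symm⟩
  have hk' := congrArg (((D.cover h𝒢 n).SV v).obj.ρ k⁻¹) hk
  rw [Literature.AlgebraicGeometry.Frobenioids.QuasiTemperoid.BTempConnected.ρ_inv_apply] at hk'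
  exact hk'

/-- **(I2), tree half: an element of `π₁^temp(𝒢)` fixing every vertex `[t n]` lies in the image of the
decomposition homomorphism at `t`** (compactness of `Π_v`: the closed cosets `{k | σ_n^k = ρ_n(g)}`
decrease in `n` and are nonempty). [cite: MochizukiSemiAnbd2006, Thm 3.7(iii) p.41] -/
theorem mem_range_decompHom_of_fixes (g : D.temperedPi h𝒢)
    (hg : ∀ n, (D.treeAct h𝒢 n g).hom.vertexMap (T.vertex n) = T.vertex n) :
    g ∈ (T.decompHom).range := by
  have hanti : ∀ ⦃i j : ℕ⦄, i ≤ j →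
      {k : 𝒢.Gv v | T.gal j k = D.proj h𝒢 j g} ⊆ {k : 𝒢.Gv v | T.gal i k = D.proj h𝒢 i g} := by
    intro i j hij k hk
    change T.gal i k = D.proj h𝒢 i g
    change T.gal j k = D.proj h𝒢 j g at hk
    have e1 : D.mapLE h𝒢 hij (T.gal j k) = T.gal i k :=
      D.mapLE_of_step h𝒢 (fun n => T.gal n k) (fun n => T.step_gal n k) hij
    rw [← e1, hk, D.mapLE_proj]
  obtain ⟨k, hk⟩ := exists_mem_forall_of_antitone (fun n => {k : 𝒢.Gv v | T.gal n k = D.proj h𝒢 n g})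
    hanti (fun n => T.exists_gal_eq_proj_of_fixes n g (hg n)) (fun n => T.isClosed_setOf_gal_eq n _)
  exact ⟨k, (T.eq_decompHom g k fun n => by rw [← (hk n : T.gal n k = D.proj h𝒢 n g)]; exact T.gal_apply n k).symm⟩

end PointSeq

/-! ### Compatible point sequences over a compatible vertex system -/

section Existence

variable {D h𝒢}

/-- A point of `𝒢_{∞,n}` over a given vertex `(V, p)` of `𝔾̃_n` with `V` over `v`.
[cite: MochizukiSemiAnbd2006, Prop 3.6 p.38] -/
theorem exists_point_over (n : ℕ) {v : 𝒢.graph.Vertex} (x : (D.tree n).Vertex)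
    (hv : CovObj.OVertex.base (D.S n) x.1 = v) :
    ∃ t : ((D.cover h𝒢 n).SV v).obj.V, (D.treeIso h𝒢 n).hom.vertexMap (Quot.mk _ ⟨v, t⟩) = x := by
  subst hv
  obtain ⟨V, p⟩ := x
  obtain ⟨y, hy⟩ := CovObj.OVertex.exists_rep (D.S n) V
  exact ⟨⟨⟨V, rfl⟩, ⟨⟨y, hy⟩, p⟩⟩, rfl⟩

/-- The next point: over `x (n+1)` and mapping to a given point over `treeStep (x (n+1))`.
[cite: MochizukiSemiAnbd2006, Thm 3.7(iii) p.41] -/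
theorem exists_point_next (n : ℕ) {v : 𝒢.graph.Vertex} (x' : (D.tree (n + 1)).Vertex)
    (hv : CovObj.OVertex.base (D.S (n + 1)) x'.1 = v) (t : ((D.cover h𝒢 n).SV v).obj.V)
    (ht : (D.treeIso h𝒢 n).hom.vertexMap (Quot.mk _ ⟨v, t⟩) = (D.treeStep n).vertexMap x') :
    ∃ t' : ((D.cover h𝒢 (n + 1)).SV v).obj.V,
      (D.treeIso h𝒢 (n + 1)).hom.vertexMap (Quot.mk _ ⟨v, t'⟩) = x' ∧
        ((D.stepCover h𝒢 n).fV v).hom.hom t' = t := by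
  obtain ⟨t₀, ht₀⟩ := exists_point_over (h𝒢 := h𝒢) (n + 1) x' hv
  -- `stepCover t₀` and `t` lie over the same vertex of `𝔾̃_n`, hence differ by some `k ∈ Π_v`
  have h1 : (D.treeIso h𝒢 n).hom.vertexMap (Quot.mk _ ⟨v, ((D.stepCover h𝒢 n).fV v).hom.hom t₀⟩) =
      (D.treeIso h𝒢 n).hom.vertexMap (Quot.mk _ ⟨v, t⟩) := by
    rw [← D.treeStep_vertexMap_mk h𝒢 n, ht₀, ht]
  obtain ⟨k, hk⟩ := (D.cover h𝒢 n).exists_ρ_of_mk_eq_mk (D.mk_eq_mk_of_vertexMap_eq h𝒢 n _ _ h1)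
  refine ⟨((D.cover h𝒢 (n + 1)).SV v).obj.ρ k t₀, ?_, ?_⟩
  · rw [← ht₀]
    exact congrArg _ (Quot.sound (CovObj.VRel.mk (S := D.cover h𝒢 (n + 1)) v k t₀)).symm
  · rw [D.stepCover_ρ h𝒢 n, hk]

variable (x : ∀ n, (D.tree n).Vertex) (hx : ∀ n, (D.treeStep n).vertexMap (x (n + 1)) = x n)

include hx in
/-- All vertices of a compatible vertex system lie over the same vertex of `𝔾`.
[cite: MochizukiSemiAnbd2006, Thm 3.7(iii) p.41] -/
theorem base_eq_of_compatible (n : ℕ) :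
    CovObj.OVertex.base (D.S n) (x n).1 = CovObj.OVertex.base (D.S 0) (x 0).1 := by
  induction n with
  | zero => rfl
  | succ n ih =>
    rw [← ih, ← D.treeProj_vertexMap n, ← D.treeProj_vertexMap (n + 1), ← hx n,
      ← Function.comp_apply (f := (D.treeProj n).vertexMap), ← SemiGraph.comp_vertexMap, D.treeStep_over]

/-- A compatible point sequence over the compatible vertex system `x`, built by dependent choice.
[cite: MochizukiSemiAnbd2006, Thm 3.7(iii) p.41] -/
private noncomputable def seqOver : ∀ n,
    {t : ((D.cover h𝒢 n).SV (CovObj.OVertex.base (D.S 0) (x 0).1)).obj.V //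
      (D.treeIso h𝒢 n).hom.vertexMap (Quot.mk _ ⟨_, t⟩) = x n}
  | 0 => ⟨(exists_point_over (h𝒢 := h𝒢) 0 (x 0) rfl).choose,
      (exists_point_over (h𝒢 := h𝒢) 0 (x 0) rfl).choose_spec⟩
  | n + 1 =>
    ⟨(exists_point_next (h𝒢 := h𝒢) n (x (n + 1)) (base_eq_of_compatible x hx (n + 1)) (seqOver n).1
        ((seqOver n).2.trans (hx n).symm)).choose,
      (exists_point_next (h𝒢 := h𝒢) n (x (n + 1)) (base_eq_of_compatible x hx (n + 1)) (seqOver n).1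
        ((seqOver n).2.trans (hx n).symm)).choose_spec.1⟩

/-- **A compatible point sequence over the compatible vertex system `x`** (dependent choice along the
tower: each point is chosen over `x (n+1)` and above the previous one). [cite: MochizukiSemiAnbd2006, Thm 3.7(iii) p.41] -/
noncomputable def pointSeqOver : D.PointSeq h𝒢 (CovObj.OVertex.base (D.S 0) (x 0).1) where
  pt n := (seqOver (h𝒢 := h𝒢) x hx n).1
  compat n := (exists_point_next (h𝒢 := h𝒢) n (x (n + 1)) (base_eq_of_compatible x hx (n + 1))
    (seqOver (h𝒢 := h𝒢) x hx n).1 ((seqOver (h𝒢 := h𝒢) x hx n).2.trans (hx n).symm)).choose_spec.2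

/-- The vertex system of `pointSeqOver x` is `x`. [cite: MochizukiSemiAnbd2006, Thm 3.7(iii) p.41] -/
theorem pointSeqOver_vertex (n : ℕ) : (pointSeqOver (h𝒢 := h𝒢) x hx).vertex n = x n :=
  (seqOver (h𝒢 := h𝒢) x hx n).2

end Existence

/-! ### (I2), tree half, for an arbitrary compatible vertex system -/

/-- **Every compatible vertex system of the trees `𝔾̃_n` is the vertex system of a compatible point
sequence** over the common base vertex. [cite: MochizukiSemiAnbd2006, Thm 3.7(iii) p.41] -/
theorem exists_pointSeq_vertex_eq (x : ∀ n, (D.tree n).Vertex)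
    (hx : ∀ ⦃i j : ℕ⦄ (h : i ≤ j), (D.treeTrans h).vertexMap (x j) = x i) :
    ∃ (v : 𝒢.graph.Vertex) (T : D.PointSeq h𝒢 v), ∀ n, T.vertex n = x n := by
  have hx' : ∀ n, (D.treeStep n).vertexMap (x (n + 1)) = x n := fun n => by
    rw [← D.treeTrans_le_succ n]; exact hx (Nat.le_succ n)
  exact ⟨_, pointSeqOver (h𝒢 := h𝒢) x hx', pointSeqOver_vertex (h𝒢 := h𝒢) x hx'⟩

/-- **(I2), tree half: the pointwise stabiliser in `π₁^temp(𝒢)` of a compatible vertex system of the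
trees `𝔾̃_n` lies in the image of a decomposition homomorphism `Π_v → π₁^temp(𝒢)`** (for the common
base vertex `v` of the system; what remains for (I2) is that this image is a verticial subgroup).
[cite: MochizukiSemiAnbd2006, Thm 3.7(iii) p.41] -/
theorem exists_decompHom_range_of_fixes (x : ∀ n, (D.tree n).Vertex)
    (hx : ∀ ⦃i j : ℕ⦄ (h : i ≤ j), (D.treeTrans h).vertexMap (x j) = x i) :
    ∃ (v : 𝒢.graph.Vertex) (T : D.PointSeq h𝒢 v), (∀ n, T.vertex n = x n) ∧
      ∀ g : D.temperedPi h𝒢, (∀ n, (D.treeAct h𝒢 n g).hom.vertexMap (x n) = x n) →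
        g ∈ (T.decompHom).range := by
  obtain ⟨v, T, hT⟩ := D.exists_pointSeq_vertex_eq h𝒢 x hx
  refine ⟨v, T, hT, fun g hg => T.mem_range_decompHom_of_fixes g fun n => ?_⟩
  rw [hT n]
  exact hg n

end GaloisLevelData

end ProfiniteSemiGraph

end Literature.AnabelianGeometry.SemiGraphs
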